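import Literature.AlgebraicGeometry.AbelianSchemes.RoofTranslateComposite        -- ★ (C5a): roof currency, bookkeeping, descent, cancellations, dual calculus, `[N]` finite flat onto
import HarnessLib

/-!
# The COMPARISON LEG `φ♭ : A″ → B₂` between two `p`-isogeny roofs `A —q→ B ←c— A″` and `A —q₀→ B₂ ←c₀— A_t` with the same source:
# `[p] ≫ φ♭ = c ≫ d′ ≫ q₀`, its equivariance, similitude and level rows, and its kernel on the two blocks
# ([MumfordAV1970] §7 Thm. 4, §15 Thm. 1, §23; [Liu2021] Prop. D.8 (2)(3))

Topic `AlgebraicGeometry/AbelianSchemes`, namespace `Literature.AlgebraicGeometry.AbelianSchemes.AbelianSchemeOver` (sequel to ★ (C5a) `RoofTranslateComposite`,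
★ (ρ2″) `RoofKernelIdealTorsion`).  THEOREMS ONLY (no definition, no named fact, no `instance`, no notation, no `sorry`).  Cell `hodgecm-mathlib` (D-0151), F0∕P6
«MOD», line L2 (socket `stub_DOWN`, D6 road), organ **(H4′-φ♭) «THE COMPARISON LEG»** (LA2-plan (g2) road ruling 2026-09-02T09:18:21Z (ii): (HC2-img) ⇐ (H4′-φ♭) ∧
(C6′-Ω) ∧ (U); payer LA2-p03 (g3)).  `--supports stmt-HodgeConjecture-24832`, count-neutral.  HONEST LABEL: HC_CM is proved only modulo the cell's 2 remaining named
inputs (hLiu418 24832, h413 24833) until rung 0 closes; this file is generic and discharges none of them.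

## Mathematics (`Ω = Ω̄` of characteristic `0`; pairing-free; everything on `Ω`-points, kernels of isogenies being decided there)

A commutative ring `𝒪` acting on abelian `Ω`-schemes `A, A″` (`ι`, `ι″`); two ROOFS of homomorphisms sharing the source `A`: roof₁ `A —q→ B ←c— A″` with (r1)
`Ker q(Ω) = K`, `K` killed by `ι(𝔭𝔭′)`, (r2) `Ker c(Ω) = A″[𝔭](Ω)`, (r3) `q^*λ_B = p·λ`, `c^*λ_B = p·λ″`, (r4) common intertwiners `b_a` (`ι(a) ≫ q = q ≫ b_a`,
`ι″(a) ≫ c = c ≫ b_a`), (r5) `q(σᵢ) = c(σ″ᵢ)`; roof₀ `A —q₀→ B₂ ←c₀— A_t` with `A[𝔭′](Ω) = Ker q₀(Ω)`, (r3₀) `q₀^*λ_{B₂} = p·λ`, (r4₀) `b⁰_a`, (r5₀) `q₀(σᵢ) = c₀(σᵗᵢ)`.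
Two ideals `𝔭, 𝔭′` with `p ∈ 𝔭`, `p ∈ 𝔭′`, read through a CRT element `ε` (`ε ≡ 1 (𝔭)`, `ε𝔭 ⊆ (p)`, `ε ∈ 𝔭′` — it exists when `p` is UNRAMIFIED at the maximal ideal
`𝔭`, §0) and the unramifiedness `𝔭′ ⊆ 𝔭′² + (p)` at `𝔭′` (§0).  In [Liu2021] Prop. D.8: `𝒪 = 𝒪_F`, `𝔭 = 𝔭_w`, `𝔭′ = 𝔭_{w̄}`, roof₁ = the `t₁(w)`-roof at `(y, L)`,
roof₀ = the central `⟨ϖ⟩`-roof at `y`.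
* §1 RETURN HOM of the quotient leg: `Ker q ⊆ A[p]`, so `[p]_A` descends through the fppf `q` (★ descent; kernels decided on `Ω`-points in characteristic `0`):
  `q ≫ d′ = [p]`, `d′ ≫ q = [p]_B`, `b_a ≫ d′ = d′ ≫ ι(a)`, hence `ι″(a) ≫ c ≫ d′ = c ≫ d′ ≫ ι(a)`.
* §2 `ξ := c ≫ d′ ≫ q₀` KILLS `A″[p]`: for `x ∈ A″[p]`, `a := d′(c x)` has `q a = (c x)^p = 1`, so `ι(𝔭𝔭′) a = 1`; and `ι(ε)a = d′ c (ι″(ε)x) = 1` since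
  `ι″(ε)x ∈ A″[𝔭] = Ker c`; with `β = β(1−ε) + βε` every `β ∈ 𝔭′` kills `a`, so `a ∈ A[𝔭′] ⊆ Ker q₀`.  Hence **`[p] ≫ φ♭ = ξ`** for a unique homomorphism `φ♭ : A″ → B₂`.
* §3 ROWS of `φ♭`: (ACT) `ι″(a) ≫ φ♭ = φ♭ ≫ b⁰_a` (cancel `[p]`), so `Ker φ♭(Ω)` is `ι″`-stable (`b⁰_a` is a homomorphism, `q₀` being an fppf epimorphism); (SIM)
  `φ♭ ≫ λ_{B₂} ≫ φ♭^∨ = λ″ ≫ [p]` — from `ξ ≫ λ_{B₂} ≫ ξ^∨ = λ″ ≫ [p³]` (★ dual calculus with `d′ ≫ λ ≫ d′^∨ = λ_B ≫ [p]`) cancel `[p]` left and right; (LVL)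
  `φ♭(σ″ᵢ) = c₀(σᵗᵢ)` for `N`-torsion families with `p·m ≡ 1 (N)`.
* §4 KERNEL of `φ♭` on `Ω`-points: (K2♭) `Ker φ♭ ⊆ A″[𝔭𝔭′]` and (V♭ ⇒) `x ∈ Ker φ♭ ⇒ c x ∈ q(A[𝔭′])`; (V♭ ⇐) `x ∈ A″[𝔭′]`, `c x ∈ q(A[𝔭′]) ⇒ φ♭ x = 1` (uses
  `𝔭′ ⊆ 𝔭′² + (p)`); (W♭ ⇐) `R ∈ A[𝔭]`, `c x = q R ⇒ φ♭(x^p) = 1`, `x^p ∈ A″[𝔭]`; (W♭ ⇒) `x ∈ Ker φ♭ ∩ A″[𝔭] ⇒ x = x₁^p` with `c x₁ ∈ q(A[𝔭])` (uses `ε`).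
  On lattices (`T = T_w ⊕ T_w̄`, `T″ = ϖ(T_w + K̃_w) ⊕ (T_w̄ + L̃)`): `Ker φ♭ = T_w∕ϖ(T_w + K̃_w) ⊕ ϖ⁻¹T_w̄∕(T_w̄ + L̃)` — the `w̄`-part is the IMAGE LINE of roof₁.
The counts and the consumer-shaped package are in the sequel ★ `RoofFlatComparisonLegKernel`.

## References
* [MumfordAV1970] D. Mumford, *Abelian Varieties* (1970), §7 Thm. 4 (p. 72), §15 Thm. 1 (p. 143), §19 Thm. 3 (p. 176), §23 Thm. 2 (p. 231).
* [Liu2021] Y. Liu, *Fourier–Jacobi cycles and arithmetic relative trace formula*, Camb. J. Math. 9 (2021), App. D, Prop. D.8 (2)(3) (p. 135), pp. 136–138.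
* [NeukirchANT1999] J. Neukirch, *Algebraic Number Theory* (1999), Ch. I §3 (3.6).
* [MumfordFogartyKirwan1994] D. Mumford, J. Fogarty, F. Kirwan, *Geometric Invariant Theory* (1994), Ch. 7 §2 Definition 7.1 (p. 129).
-/

set_option autoImplicit false

noncomputable section

set_option backward.isDefEq.respectTransparency false

open CategoryTheory CategoryTheory.Limits AlgebraicGeometry MonoidalCategory CartesianMonoidalCategory
open scoped MonObj CategoryTheory.Obj Pointwise
open Literature.AlgebraicGeometry.Motives (AlgPoints SchemeOver specOver)

namespace Literature.AlgebraicGeometry.AbelianSchemes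

namespace AbelianSchemeOver

/-! ## §0 Two CRT facts at an unramified prime of a Dedekind domain -/

section CRT

variable {O : Type*} [CommRing O] [IsDedekindDomain O]

/-- **`P ⊆ P² + (x)` for a maximal ideal `P ∋ x` with `P² ∤ (x)`** (`(x) = P·J`, `P ∤ J`, so `P + J = (1)` and `P = P(P + J) = P² + (x)`).
[cite: NeukirchANT1999, Ch. I §3 (3.6)] -/
theorem le_sq_sup_span_of_not_sq_dvd_span {P : Ideal O} (hP : P.IsMaximal) {x : O} (hx : x ∈ P) (h : ¬ P ^ 2 ∣ Ideal.span {x}) :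
    P ≤ P ^ 2 ⊔ Ideal.span {x} := by
  obtain ⟨J, hJ⟩ : P ∣ Ideal.span {x} := (Ideal.dvd_span_singleton).2 hx
  have hPJ : ¬ J ≤ P := fun hle => h (by
    obtain ⟨K, hK⟩ := (Ideal.dvd_iff_le).2 hle
    exact ⟨K, by rw [hJ, hK, ← mul_assoc, sq]⟩)
  have hsup : P ⊔ J = ⊤ := by
    refine hP.out.2 _ (lt_of_le_of_ne le_sup_left fun heq => hPJ ?_)
    rw [heq]; exact le_sup_right
  calc P = P * (P ⊔ J) := by rw [hsup, Ideal.mul_top]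
    _ = P ^ 2 ⊔ Ideal.span {x} := by rw [Ideal.mul_sup, ← sq, ← hJ]
    _ ≤ P ^ 2 ⊔ Ideal.span {x} := le_rfl

/-- **THE CRT ELEMENT AT AN UNRAMIFIED MAXIMAL IDEAL `P ∋ x` (`P² ∤ (x)`)**: with `(x) = P·J`, `P + J = (1)`, `1 = u + v`, the element `ε := v` satisfies `ε ≡ 1 (P)`,
`ε·P ⊆ (x)` and `ε ∈ Q` for every prime `Q ∋ x` other than `P` (as `P·J ⊆ Q` and `P ⊄ Q`). [cite: NeukirchANT1999, Ch. I §3 (3.6)] -/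
theorem exists_crt_of_not_sq_dvd_span {P : Ideal O} (hP : P.IsMaximal) {x : O} (hx : x ∈ P) (h : ¬ P ^ 2 ∣ Ideal.span {x}) :
    ∃ ε : O, ε - 1 ∈ P ∧ (∀ α ∈ P, α * ε ∈ Ideal.span {x}) ∧ ∀ Q : Ideal O, Q.IsPrime → x ∈ Q → Q ≠ P → ε ∈ Q := by
  obtain ⟨J, hJ⟩ : P ∣ Ideal.span {x} := (Ideal.dvd_span_singleton).2 hx
  have hPJ : ¬ J ≤ P := fun hle => h (by
    obtain ⟨K, hK⟩ := (Ideal.dvd_iff_le).2 hle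
    exact ⟨K, by rw [hJ, hK, ← mul_assoc, sq]⟩)
  have hsup : P ⊔ J = ⊤ := by
    refine hP.out.2 _ (lt_of_le_of_ne le_sup_left fun heq => hPJ ?_)
    rw [heq]; exact le_sup_right
  obtain ⟨u, hu, v, hv, huv⟩ := Submodule.mem_sup.mp ((Ideal.eq_top_iff_one _).mp hsup)
  refine ⟨v, ?_, fun α hα => ?_, fun Q hQ hxQ hQP => ?_⟩
  · have e : v - 1 = -u := by rw [← huv]; ring
    rw [e]; exact P.neg_mem hu
  · rw [hJ]; exact Ideal.mul_mem_mul hα hv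
  · have hle : P * J ≤ Q := by rw [← hJ, Ideal.span_singleton_le_iff_mem]; exact hxQ
    rcases hQ.mul_le.1 hle with hPQ | hJQ
    · exact absurd (hP.eq_of_le hQ.ne_top hPQ).symm hQP
    · exact hJQ hv

omit [IsDedekindDomain O] in
/-- An element of two COMAXIMAL ideals lies in their product (`I ∩ J = I·J`). [cite: NeukirchANT1999, Ch. I §3 (3.6)] -/
theorem mem_mul_of_mem_of_mem_of_sup_eq_top {I J : Ideal O} (hIJ : I ⊔ J = ⊤) {x : O} (hxI : x ∈ I) (hxJ : x ∈ J) : x ∈ I * J := by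
  rw [Ideal.mul_eq_inf_of_coprime hIJ]
  exact ⟨hxI, hxJ⟩

end CRT

section FlatLeg

variable {O : Type*} [CommRing O] {Ω : Type} [Field Ω]
  {A A'' At B B₂ : AbelianSchemeOver (Spec (.of Ω))}
  (act : A.RingAction O) (act'' : A''.RingAction O)
  (q : A.X ⟶ B.X) (c : A''.X ⟶ B.X) (q₀ : A.X ⟶ B₂.X)

/-! ## §1 The return hom `d′` of the quotient leg `q`: `q ≫ d′ = [p]`, `d′ ≫ q = [p]_B`, `b_a ≫ d′ = d′ ≫ ι(a)` -/

/-- **THE RETURN HOM OF A LEG WHOSE KERNEL IS `p`-TORSION** (`Ω = Ω̄`, characteristic `0`; `q` finite surjective; every `Ω`-point killed by `q` is `p`-torsion):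
`q ≫ d′ = [p]_A` and `d′ ≫ q = [p]_B` for a homomorphism `d′` (descent through the fppf cover `q`, kernels decided on `Ω`-points).
[cite: MumfordAV1970, §7 Thm. 4 (p. 72)] -/
theorem exists_returnHom_quotient [IsAlgClosed Ω] [CharZero Ω] [IsMonHom q] [IsFinite q.left] [Surjective q.left] {p : ℕ}
    (hqp : ∀ P : specOver Ω Ω ⟶ A.X, P ≫ q = 1 → P ^ p = 1) :
    ∃ d' : B.X ⟶ A.X, IsMonHom d' ∧ q ≫ d' = A.mulN p ∧ d' ≫ q = B.mulN p := by
  haveI : IsCommMonObj A.X := A.isCommMonObj_of_isReduced_base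
  haveI : IsCommMonObj B.X := B.isCommMonObj_of_isReduced_base
  haveI : IsMonHom (A.mulN p) := A.isMonHom_mulN p
  haveI : IsMonHom (B.mulN p) := B.isMonHom_mulN p
  haveI : Flat q.left := flat_left_of_isFinite_of_surjective q
  have hker : ∀ ⦃T : Over (Spec (.of Ω))⦄ (t : T ⟶ A.X), t ≫ q = 1 → t ≫ A.mulN p = 1 := fun T t ht =>
    comp_eq_one_of_forall_algPoints_of_charZero q (A.mulN p) (fun P hP => by
      rw [mulN_def, MonObj.comp_pow, Category.comp_id]
      exact hqp P hP) t ht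
  obtain ⟨d', hqd', -⟩ := A.existsUnique_comp_eq_of_forall_comp_eq_one q (A.mulN p) hker
  haveI : IsMonHom d' := A.isMonHom_of_comp_eq q (A.mulN p) hqd'
  refine ⟨d', inferInstance, hqd', ?_⟩
  apply A.cancel_left_of_flat_surjective q
  rw [← Category.assoc, hqd', mulN_def, mulN_def]
  exact (A.comp_pow_id_eq_pow_id_comp q p).symm

/-- **A COMMON INTERTWINER COMMUTES WITH THE RETURN HOM OF THE QUOTIENT LEG**: `ι(a) ≫ q = q ≫ b` ⟹ `b ≫ d′ = d′ ≫ ι(a)` (cancel the epimorphism `q`: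
both sides precompose with `q` to `ι(a) ≫ [p] = [p] ≫ ι(a)`). [cite: MumfordAV1970, §7 Thm. 4 (p. 72)] -/
theorem intertwiner_comp_returnHom_quotient [IsMonHom q] [IsFinite q.left] [Surjective q.left] {p : ℕ}
    (d' : B.X ⟶ A.X) (hqd' : q ≫ d' = A.mulN p) (a : O) (b : B.X ⟶ B.X) (hb : act.i a ≫ q = q ≫ b) :
    b ≫ d' = d' ≫ act.i a := by
  haveI := act.isMonHom a
  haveI : Flat q.left := flat_left_of_isFinite_of_surjective q
  apply A.cancel_left_of_flat_surjective q
  rw [← Category.assoc, ← hb, Category.assoc, hqd', ← Category.assoc, hqd', mulN_def]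
  exact A.comp_pow_id_eq_pow_id_comp (act.i a) p

/-- **`c ≫ d′` IS EQUIVARIANT**: `ι″(a) ≫ c ≫ d′ = c ≫ d′ ≫ ι(a)` from the common intertwiner of the roof (r4). [cite: Liu2021, Prop. D.8 (2) p. 135]
[cite: MumfordAV1970, §7 Thm. 4 (p. 72)] -/
theorem equivariant_cover_comp_returnHom [IsMonHom q] [IsFinite q.left] [Surjective q.left] {p : ℕ}
    (d' : B.X ⟶ A.X) (hqd' : q ≫ d' = A.mulN p)
    (h4 : ∀ a : O, ∃ b : B.X ⟶ B.X, act.i a ≫ q = q ≫ b ∧ act''.i a ≫ c = c ≫ b) (a : O) :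
    act''.i a ≫ c ≫ d' = c ≫ d' ≫ act.i a := by
  obtain ⟨b, hbq, hbc⟩ := h4 a
  rw [← Category.assoc, hbc, Category.assoc, intertwiner_comp_returnHom_quotient act q d' hqd' a b hbq]

/-! ## §2 `ξ := c ≫ d′ ≫ q₀` kills `A″[p]`; the comparison leg `φ♭` with `[p] ≫ φ♭ = ξ` -/

/-- **`x ∈ A″[p] ⟹ d′(c x) ∈ A[𝔭′]`** (the heart of «`ξ` kills `A″[p]`»): `a := d′(c x)` is killed by `q` (`q a = (c x)^p = 1`), hence by `ι(𝔭𝔭′)` (`hK`); and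
`ι(ε) a = d′ c (ι″(ε) x) = 1` because `ι″(ε) x ∈ A″[𝔭] ⊆ Ker c` (`ε𝔭 ⊆ (p)`); with `β = (1−ε)β + βε` and `1 − ε ∈ 𝔭`, every `β ∈ 𝔭′` kills `a`.
[cite: Liu2021, Prop. D.8 (2)(3) p. 135, pp. 136–138] [cite: MumfordAV1970, §7 Thm. 4 (p. 72)] -/
theorem cover_comp_returnHom_torsion_of_pow_eq_one [IsMonHom c] {p : ℕ} (𝔭 𝔭' : Ideal O)
    (d' : B.X ⟶ A.X) [IsMonHom d'] (hd'q : d' ≫ q = B.mulN p)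
    (hK : ∀ P : specOver Ω Ω ⟶ A.X, P ≫ q = 1 → ∀ a ∈ 𝔭 * 𝔭', P ≫ act.i a = 1)
    (hkc : ∀ P : specOver Ω Ω ⟶ A''.X, (∀ a ∈ 𝔭, P ≫ act''.i a = 1) → P ≫ c = 1)
    (hequiv : ∀ a : O, act''.i a ≫ c ≫ d' = c ≫ d' ≫ act.i a)
    (ε : O) (hε1 : ε - 1 ∈ 𝔭) (hε2 : ∀ α ∈ 𝔭, α * ε ∈ Ideal.span {(p : O)})
    (x : specOver Ω Ω ⟶ A''.X) (hx : x ^ p = 1) :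
    ∀ β ∈ 𝔭', (x ≫ c ≫ d') ≫ act.i β = 1 := by
  haveI := act.isMonHom
  haveI := act''.isMonHom
  haveI : IsCommMonObj B.X := B.isCommMonObj_of_isReduced_base
  haveI : IsMonHom (B.mulN p) := B.isMonHom_mulN p
  -- (i) `q` kills `a := d′(c x)`, so `ι(𝔭𝔭′)` kills it
  have hqa : (x ≫ c ≫ d') ≫ q = 1 := by
    rw [Category.assoc, Category.assoc, hd'q, mulN_def, MonObj.comp_pow, Category.comp_id, MonObj.comp_pow, ← MonObj.pow_comp, hx,
      MonObj.one_comp]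
  have hKa : ∀ a ∈ 𝔭 * 𝔭', (x ≫ c ≫ d') ≫ act.i a = 1 := hK _ hqa
  -- (ii) `ι(ε)` kills `a`: `ι″(ε) x ∈ A″[𝔭] ⊆ Ker c`
  have hxε : (x ≫ act''.i ε) ≫ c = 1 := by
    refine hkc _ fun α hα => ?_
    obtain ⟨r, hr⟩ := Ideal.mem_span_singleton'.mp (hε2 α hα)
    rw [Category.assoc, ← act''.i_mul, ← hr, act''.comp_i_mul, comp_i_natCast act'' x p, hx, MonObj.one_comp]
  have hεa : (x ≫ c ≫ d') ≫ act.i ε = 1 := by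
    rw [Category.assoc, Category.assoc, ← hequiv ε, ← Category.assoc, ← Category.assoc, hxε, MonObj.one_comp]
  -- (iii) `β = (1 − ε)β + βε`
  intro β hβ
  have h1ε : 1 - ε ∈ 𝔭 := by
    have e : 1 - ε = -(ε - 1) := by ring
    rw [e]; exact 𝔭.neg_mem hε1
  have e : β = (1 - ε) * β + β * ε := by ring
  conv_lhs => rw [e]
  rw [act.comp_i_add, hKa _ (Ideal.mul_mem_mul h1ε hβ), one_mul, act.comp_i_mul, hεa, MonObj.one_comp]

/-- **`ξ := c ≫ d′ ≫ q₀` KILLS EVERY `p`-TORSION `Ω`-POINT OF `A″`** (`d′(c x) ∈ A[𝔭′] ⊆ Ker q₀`). [cite: Liu2021, Prop. D.8 (2)(3) p. 135, pp. 136–138]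
[cite: MumfordAV1970, §7 Thm. 4 (p. 72)] -/
theorem comp_xi_eq_one_of_pow_eq_one [IsMonHom c] {p : ℕ} (𝔭 𝔭' : Ideal O)
    (d' : B.X ⟶ A.X) [IsMonHom d'] (hd'q : d' ≫ q = B.mulN p)
    (hK : ∀ P : specOver Ω Ω ⟶ A.X, P ≫ q = 1 → ∀ a ∈ 𝔭 * 𝔭', P ≫ act.i a = 1)
    (hkc : ∀ P : specOver Ω Ω ⟶ A''.X, (∀ a ∈ 𝔭, P ≫ act''.i a = 1) → P ≫ c = 1)
    (hkq₀ : ∀ P : specOver Ω Ω ⟶ A.X, (∀ a ∈ 𝔭', P ≫ act.i a = 1) → P ≫ q₀ = 1)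
    (hequiv : ∀ a : O, act''.i a ≫ c ≫ d' = c ≫ d' ≫ act.i a)
    (ε : O) (hε1 : ε - 1 ∈ 𝔭) (hε2 : ∀ α ∈ 𝔭, α * ε ∈ Ideal.span {(p : O)})
    (x : specOver Ω Ω ⟶ A''.X) (hx : x ^ p = 1) :
    x ≫ (c ≫ d' ≫ q₀) = 1 := by
  have h := hkq₀ (x ≫ c ≫ d') (cover_comp_returnHom_torsion_of_pow_eq_one act act'' q c 𝔭 𝔭' d' hd'q hK hkc hequiv ε hε1 hε2 x hx)
  simpa only [Category.assoc] using h

/-- **THE COMPARISON LEG `φ♭`**: `ξ = c ≫ d′ ≫ q₀` kills `A″[p]` on `Ω`-points, hence on all `T`-points (★ kernels decided on points, characteristic `0`), so it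
DESCENDS through the fppf cover `[p]_{A″}`: `[p] ≫ φ♭ = ξ` for a homomorphism `φ♭ : A″ → B₂`. [cite: MumfordAV1970, §7 Thm. 4 (p. 72)]
[cite: Liu2021, Prop. D.8 (2)(3) p. 135, pp. 136–138] -/
theorem exists_flatLeg [IsAlgClosed Ω] [CharZero Ω] [IsMonHom c] [IsMonHom q₀] {p : ℕ} (hp : p ≠ 0) (𝔭 𝔭' : Ideal O)
    (d' : B.X ⟶ A.X) [IsMonHom d'] (hd'q : d' ≫ q = B.mulN p)
    (hK : ∀ P : specOver Ω Ω ⟶ A.X, P ≫ q = 1 → ∀ a ∈ 𝔭 * 𝔭', P ≫ act.i a = 1)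
    (hkc : ∀ P : specOver Ω Ω ⟶ A''.X, (∀ a ∈ 𝔭, P ≫ act''.i a = 1) → P ≫ c = 1)
    (hkq₀ : ∀ P : specOver Ω Ω ⟶ A.X, (∀ a ∈ 𝔭', P ≫ act.i a = 1) → P ≫ q₀ = 1)
    (hequiv : ∀ a : O, act''.i a ≫ c ≫ d' = c ≫ d' ≫ act.i a)
    (ε : O) (hε1 : ε - 1 ∈ 𝔭) (hε2 : ∀ α ∈ 𝔭, α * ε ∈ Ideal.span {(p : O)}) :
    ∃ φ : A''.X ⟶ B₂.X, IsMonHom φ ∧ A''.mulN p ≫ φ = c ≫ d' ≫ q₀ := by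
  haveI : IsCommMonObj A''.X := A''.isCommMonObj_of_isReduced_base
  haveI : IsMonHom (A''.mulN p) := A''.isMonHom_mulN p
  haveI : Surjective (A''.mulN p).left := A''.surjective_pow_id_left_of_ne_zero hp
  haveI : IsFinite (A''.mulN p).left := A''.isFinite_pow_id_left_of_ne_zero hp
  haveI : Flat (A''.mulN p).left := flat_left_of_isFinite_of_surjective (A''.mulN p)
  have hker : ∀ ⦃T : Over (Spec (.of Ω))⦄ (t : T ⟶ A''.X), t ≫ A''.mulN p = 1 → t ≫ (c ≫ d' ≫ q₀) = 1 := fun T t ht =>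
    comp_eq_one_of_forall_algPoints_of_charZero (A''.mulN p) (c ≫ d' ≫ q₀) (fun P hP => by
      rw [mulN_def, MonObj.comp_pow, Category.comp_id] at hP
      exact comp_xi_eq_one_of_pow_eq_one act act'' q c q₀ 𝔭 𝔭' d' hd'q hK hkc hkq₀ hequiv ε hε1 hε2 P hP) t ht
  obtain ⟨φ, hφ, -⟩ := A''.existsUnique_comp_eq_of_forall_comp_eq_one (A''.mulN p) (c ≫ d' ≫ q₀) hker
  exact ⟨φ, A''.isMonHom_of_comp_eq (A''.mulN p) (c ≫ d' ≫ q₀) hφ, hφ⟩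

/-! ## §3 The rows of `φ♭`: equivariance (and stability of its kernel), similitude, level points -/

/-- **(ACT) `ι″(a) ≫ φ♭ = φ♭ ≫ b⁰_a`** for the intertwiner `b⁰_a` of roof₀ (`ι(a) ≫ q₀ = q₀ ≫ b⁰_a`): cancel the epimorphism `[p]` in
`[p] ≫ ι″(a) ≫ φ♭ = ι″(a) ≫ c ≫ d′ ≫ q₀ = c ≫ d′ ≫ ι(a) ≫ q₀ = c ≫ d′ ≫ q₀ ≫ b⁰_a = [p] ≫ φ♭ ≫ b⁰_a`. [cite: Liu2021, Prop. D.8 (2) p. 135]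
[cite: MumfordAV1970, §7 Thm. 4 (p. 72)] -/
theorem act_comp_flatLeg {p : ℕ} (hp : p ≠ 0) (d' : B.X ⟶ A.X)
    (hequiv : ∀ a : O, act''.i a ≫ c ≫ d' = c ≫ d' ≫ act.i a)
    (φ : A''.X ⟶ B₂.X) (hφ : A''.mulN p ≫ φ = c ≫ d' ≫ q₀)
    (a : O) (b₀ : B₂.X ⟶ B₂.X) (hb₀ : act.i a ≫ q₀ = q₀ ≫ b₀) :
    act''.i a ≫ φ = φ ≫ b₀ := by
  haveI := act''.isMonHom a
  haveI : IsCommMonObj A''.X := A''.isCommMonObj_of_isReduced_base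
  haveI : IsMonHom (A''.mulN p) := A''.isMonHom_mulN p
  haveI : Surjective (A''.mulN p).left := A''.surjective_pow_id_left_of_ne_zero hp
  haveI : IsFinite (A''.mulN p).left := A''.isFinite_pow_id_left_of_ne_zero hp
  haveI : Flat (A''.mulN p).left := flat_left_of_isFinite_of_surjective (A''.mulN p)
  apply A''.cancel_left_of_flat_surjective (A''.mulN p)
  have hcomm : A''.mulN p ≫ act''.i a = act''.i a ≫ A''.mulN p := by
    rw [mulN_def]; exact (A''.comp_pow_id_eq_pow_id_comp (act''.i a) p).symm
  calc A''.mulN p ≫ act''.i a ≫ φ = act''.i a ≫ (A''.mulN p ≫ φ) := by rw [← Category.assoc, hcomm, Category.assoc]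
    _ = (act''.i a ≫ c ≫ d') ≫ q₀ := by rw [hφ]; simp only [Category.assoc]
    _ = c ≫ d' ≫ (act.i a ≫ q₀) := by rw [hequiv]; simp only [Category.assoc]
    _ = (A''.mulN p ≫ φ) ≫ b₀ := by rw [hb₀, hφ]; simp only [Category.assoc]
    _ = A''.mulN p ≫ φ ≫ b₀ := by rw [Category.assoc]

/-- **THE INTERTWINERS OF roof₀ ARE HOMOMORPHISMS** (`ι(a) ≫ q₀ = q₀ ≫ b⁰_a` with `q₀` finite surjective, i.e. an fppf epimorphism).
[cite: MumfordAV1970, §7 Thm. 4 (p. 72)] -/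
theorem isMonHom_intertwiner [IsMonHom q₀] [IsFinite q₀.left] [Surjective q₀.left] (a : O) (b₀ : B₂.X ⟶ B₂.X) (hb₀ : act.i a ≫ q₀ = q₀ ≫ b₀) :
    IsMonHom b₀ := by
  haveI := act.isMonHom a
  haveI : Flat q₀.left := flat_left_of_isFinite_of_surjective q₀
  exact A.isMonHom_of_comp_eq q₀ (act.i a ≫ q₀) hb₀.symm

/-- **`Ker φ♭(Ω)` IS `ι″`-STABLE**: `φ♭ x = 1 ⟹ φ♭(ι″(a) x) = b⁰_a(φ♭ x) = 1` (the intertwiners being homomorphisms).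
[cite: MumfordAV1970, §7 Thm. 4 (p. 72)] [cite: Liu2021, Prop. D.8 (2) p. 135] -/
theorem comp_i_comp_flatLeg_eq_one [IsMonHom q₀] [IsFinite q₀.left] [Surjective q₀.left] (φ : A''.X ⟶ B₂.X)
    (hACT : ∀ a : O, ∃ b₀ : B₂.X ⟶ B₂.X, act.i a ≫ q₀ = q₀ ≫ b₀ ∧ act''.i a ≫ φ = φ ≫ b₀)
    (x : specOver Ω Ω ⟶ A''.X) (hx : x ≫ φ = 1) (a : O) : (x ≫ act''.i a) ≫ φ = 1 := by
  obtain ⟨b₀, hb₀, hφb⟩ := hACT a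
  haveI : IsMonHom b₀ := isMonHom_intertwiner act q₀ a b₀ hb₀
  rw [Category.assoc, hφb, ← Category.assoc, hx, MonObj.one_comp]

/-- **`d′ ≫ λ ≫ d′^∨ = λ_B ≫ [p]`** — the similitude of the return hom of the quotient leg ((C5a)'s `key` with the roles of `q`, `c` exchanged: cancel the fppf `q` on the left,
using `q^∨ ≫ d′^∨ = [p]` from `d′ ≫ q = [p]`). [cite: MumfordAV1970, §15 Thm. 1 (p. 143), §23 Thm. 2 (p. 231)] -/
theorem returnHom_quotient_similitude [IsMonHom q] [IsFinite q.left] [Surjective q.left] {p : ℕ}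
    (D : A.DualPair) (pol : A.Polarization D) (DB : B.DualPair) (lamB : B.X ⟶ DB.hat.X) [IsMonHom lamB]
    (hDB : Nonempty ((Scheme.Modules.pullback DB.unitHatSlice).obj DB.P ≅ SheafOfModules.unit _))
    (d' : B.X ⟶ A.X) [IsMonHom d'] (hqd' : q ≫ d' = A.mulN p) (hd'q : d' ≫ q = B.mulN p)
    (h3 : q ≫ lamB ≫ DualPair.dualIsogenyOver q D DB = pol.lam ≫ D.hat.mulN p) :
    d' ≫ pol.lam ≫ DualPair.dualIsogenyOver d' DB D = lamB ≫ DB.hat.mulN p := by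
  haveI : IsCommMonObj A.X := A.isCommMonObj_of_isReduced_base
  haveI : IsCommMonObj B.X := B.isCommMonObj_of_isReduced_base
  haveI hpol := pol.isMonHom
  have hD := pol.nonempty_unitHatSlice_iso
  haveI : IsMonHom (A.mulN p) := A.isMonHom_mulN p
  haveI : IsMonHom (B.mulN p) := B.isMonHom_mulN p
  haveI hqd : IsMonHom (DualPair.dualIsogenyOver q D DB) := DualPair.isMonHom_dualIsogenyOver q D DB hDB hD
  haveI hdd : IsMonHom (DualPair.dualIsogenyOver d' DB D) := DualPair.isMonHom_dualIsogenyOver d' DB D hD hDB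
  haveI : Flat q.left := flat_left_of_isFinite_of_surjective q
  have hqd'_dual : DualPair.dualIsogenyOver q D DB ≫ DualPair.dualIsogenyOver d' DB D = (𝟙 DB.hat.X) ^ p := by
    rw [← DualPair.dualIsogenyOver_comp d' q DB D DB, DualPair.dualIsogenyOver_congr DB DB (h₂ := B.isMonHom_mulN p) hd'q,
      DB.dualIsogenyOver_mulN hDB p, mulN_def]
  have hlam : A.mulN p ≫ pol.lam = pol.lam ≫ D.hat.mulN p := by
    rw [mulN_def, mulN_def]; exact (A.comp_pow_id_eq_pow_id_comp pol.lam p).symm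
  apply A.cancel_left_of_flat_surjective q
  calc q ≫ d' ≫ pol.lam ≫ DualPair.dualIsogenyOver d' DB D
      = (q ≫ d') ≫ pol.lam ≫ DualPair.dualIsogenyOver d' DB D := by rw [Category.assoc]
    _ = (pol.lam ≫ D.hat.mulN p) ≫ DualPair.dualIsogenyOver d' DB D := by rw [hqd', ← Category.assoc, hlam]
    _ = (q ≫ lamB ≫ DualPair.dualIsogenyOver q D DB) ≫ DualPair.dualIsogenyOver d' DB D := by rw [h3]
    _ = q ≫ lamB ≫ DB.hat.mulN p := by
        simp only [Category.assoc]; rw [hqd'_dual, mulN_def]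

set_option maxHeartbeats 400000 in
/-- **(SIM) `φ♭ ≫ λ_{B₂} ≫ φ♭^∨ = λ″ ≫ [p]`** — the comparison leg pulls the descended polarisation of roof₀ back to `p·λ″`, EXACTLY the (r3) row of a roof at `A″`:
`ξ ≫ λ_{B₂} ≫ ξ^∨ = c ≫ d′ ≫ (q₀ ≫ λ_{B₂} ≫ q₀^∨) ≫ d′^∨ ≫ c^∨ = c ≫ (d′ ≫ λ ≫ d′^∨) ≫ [p] ≫ c^∨ = (c ≫ λ_B ≫ c^∨) ≫ [p]² = λ″ ≫ [p³]`, while `ξ = [p] ≫ φ♭`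
gives `ξ ≫ λ_{B₂} ≫ ξ^∨ = [p] ≫ (φ♭ ≫ λ_{B₂} ≫ φ♭^∨) ≫ [p]`; cancel `[p]` on both sides (`[p]` fppf onto on the left; ★ `cancel_right_of_comp_eq_pow_id` on the right).
[cite: MumfordAV1970, §15 Thm. 1 (p. 143), §23 Thm. 2 (p. 231)] [cite: Liu2021, Prop. D.8 (3) p. 135] -/
theorem flatLeg_similitude [IsMonHom q] [IsMonHom c] [IsMonHom q₀] [IsFinite q.left] [Surjective q.left] {p : ℕ} (hp : p ≠ 0)
    (D : A.DualPair) (pol : A.Polarization D) (D'' : A''.DualPair) (pol'' : A''.Polarization D'')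
    (DB : B.DualPair) (lamB : B.X ⟶ DB.hat.X) [IsMonHom lamB]
    (hDB : Nonempty ((Scheme.Modules.pullback DB.unitHatSlice).obj DB.P ≅ SheafOfModules.unit _))
    (DB₂ : B₂.DualPair) (lamB₂ : B₂.X ⟶ DB₂.hat.X) [IsMonHom lamB₂]
    (hDB₂ : Nonempty ((Scheme.Modules.pullback DB₂.unitHatSlice).obj DB₂.P ≅ SheafOfModules.unit _))
    (d' : B.X ⟶ A.X) [IsMonHom d'] (hqd' : q ≫ d' = A.mulN p) (hd'q : d' ≫ q = B.mulN p)
    (h3 : q ≫ lamB ≫ DualPair.dualIsogenyOver q D DB = pol.lam ≫ D.hat.mulN p)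
    (h3'' : c ≫ lamB ≫ DualPair.dualIsogenyOver c D'' DB = pol''.lam ≫ D''.hat.mulN p)
    (h3₀ : q₀ ≫ lamB₂ ≫ DualPair.dualIsogenyOver q₀ D DB₂ = pol.lam ≫ D.hat.mulN p)
    (φ : A''.X ⟶ B₂.X) [IsMonHom φ] (hφ : A''.mulN p ≫ φ = c ≫ d' ≫ q₀) :
    φ ≫ lamB₂ ≫ DualPair.dualIsogenyOver φ D'' DB₂ = pol''.lam ≫ D''.hat.mulN p := by
  haveI : IsCommMonObj A.X := A.isCommMonObj_of_isReduced_base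
  haveI : IsCommMonObj A''.X := A''.isCommMonObj_of_isReduced_base
  haveI : IsCommMonObj B.X := B.isCommMonObj_of_isReduced_base
  haveI : IsCommMonObj B₂.X := B₂.isCommMonObj_of_isReduced_base
  haveI : IsCommMonObj D''.hat.X := D''.hat.isCommMonObj_of_isReduced_base
  haveI hpol := pol.isMonHom
  haveI hpol'' := pol''.isMonHom
  have hD := pol.nonempty_unitHatSlice_iso
  have hD'' := pol''.nonempty_unitHatSlice_iso
  haveI : IsMonHom (A.mulN p) := A.isMonHom_mulN p
  haveI : IsMonHom (A''.mulN p) := A''.isMonHom_mulN p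
  haveI : IsMonHom (B.mulN p) := B.isMonHom_mulN p
  haveI : IsMonHom (D''.hat.mulN p) := D''.hat.isMonHom_mulN p
  haveI hqd : IsMonHom (DualPair.dualIsogenyOver q D DB) := DualPair.isMonHom_dualIsogenyOver q D DB hDB hD
  haveI hcd : IsMonHom (DualPair.dualIsogenyOver c D'' DB) := DualPair.isMonHom_dualIsogenyOver c D'' DB hDB hD''
  haveI hdd : IsMonHom (DualPair.dualIsogenyOver d' DB D) := DualPair.isMonHom_dualIsogenyOver d' DB D hD hDB
  haveI hq₀d : IsMonHom (DualPair.dualIsogenyOver q₀ D DB₂) := DualPair.isMonHom_dualIsogenyOver q₀ D DB₂ hDB₂ hD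
  haveI hφd : IsMonHom (DualPair.dualIsogenyOver φ D'' DB₂) := DualPair.isMonHom_dualIsogenyOver φ D'' DB₂ hDB₂ hD''
  haveI : Surjective (A''.mulN p).left := A''.surjective_pow_id_left_of_ne_zero hp
  haveI : IsFinite (A''.mulN p).left := A''.isFinite_pow_id_left_of_ne_zero hp
  haveI : Flat (A''.mulN p).left := flat_left_of_isFinite_of_surjective (A''.mulN p)
  -- `d′ ≫ λ ≫ d′^∨ = λ_B ≫ [p]`
  have key := returnHom_quotient_similitude q D pol DB lamB hDB d' hqd' hd'q h3
  -- `[p]` commutes with homomorphisms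
  have hc1 : DualPair.dualIsogenyOver d' DB D ≫ DB.hat.mulN p = D.hat.mulN p ≫ DualPair.dualIsogenyOver d' DB D := by
    rw [mulN_def, mulN_def]; exact D.hat.comp_pow_id_eq_pow_id_comp (DualPair.dualIsogenyOver d' DB D) p
  have hc2 : DualPair.dualIsogenyOver c D'' DB ≫ D''.hat.mulN p = DB.hat.mulN p ≫ DualPair.dualIsogenyOver c D'' DB := by
    rw [mulN_def, mulN_def]; exact DB.hat.comp_pow_id_eq_pow_id_comp (DualPair.dualIsogenyOver c D'' DB) p
  have hlam'' : A''.mulN p ≫ pol''.lam = pol''.lam ≫ D''.hat.mulN p := by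
    rw [mulN_def, mulN_def]; exact (A''.comp_pow_id_eq_pow_id_comp pol''.lam p).symm
  -- (1) `ξ ≫ λ_{B₂} ≫ ξ^∨ = λ″ ≫ [p] ≫ [p] ≫ [p]`
  have hX : (c ≫ d' ≫ q₀) ≫ lamB₂ ≫ DualPair.dualIsogenyOver (c ≫ d' ≫ q₀) D'' DB₂ =
      pol''.lam ≫ D''.hat.mulN p ≫ D''.hat.mulN p ≫ D''.hat.mulN p := by
    rw [DualPair.dualIsogenyOver_comp c (d' ≫ q₀) D'' DB DB₂, DualPair.dualIsogenyOver_comp d' q₀ DB D DB₂]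
    calc (c ≫ d' ≫ q₀) ≫ lamB₂ ≫ (DualPair.dualIsogenyOver q₀ D DB₂ ≫ DualPair.dualIsogenyOver d' DB D) ≫ DualPair.dualIsogenyOver c D'' DB
        = c ≫ d' ≫ (q₀ ≫ lamB₂ ≫ DualPair.dualIsogenyOver q₀ D DB₂) ≫ DualPair.dualIsogenyOver d' DB D ≫ DualPair.dualIsogenyOver c D'' DB := by
          simp only [Category.assoc]
      _ = c ≫ d' ≫ pol.lam ≫ (D.hat.mulN p ≫ DualPair.dualIsogenyOver d' DB D) ≫ DualPair.dualIsogenyOver c D'' DB := by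
          rw [h3₀]; simp only [Category.assoc]
      _ = c ≫ (d' ≫ pol.lam ≫ DualPair.dualIsogenyOver d' DB D) ≫ DB.hat.mulN p ≫ DualPair.dualIsogenyOver c D'' DB := by
          rw [← hc1]; simp only [Category.assoc]
      _ = c ≫ lamB ≫ DB.hat.mulN p ≫ (DB.hat.mulN p ≫ DualPair.dualIsogenyOver c D'' DB) := by
          rw [key]; simp only [Category.assoc]
      _ = c ≫ lamB ≫ DB.hat.mulN p ≫ DualPair.dualIsogenyOver c D'' DB ≫ D''.hat.mulN p := by
          rw [← hc2]
      _ = c ≫ lamB ≫ DualPair.dualIsogenyOver c D'' DB ≫ D''.hat.mulN p ≫ D''.hat.mulN p := by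
          rw [← Category.assoc (DB.hat.mulN p) (DualPair.dualIsogenyOver c D'' DB) (D''.hat.mulN p), ← hc2]
          simp only [Category.assoc]
      _ = (c ≫ lamB ≫ DualPair.dualIsogenyOver c D'' DB) ≫ D''.hat.mulN p ≫ D''.hat.mulN p := by
          simp only [Category.assoc]
      _ = pol''.lam ≫ D''.hat.mulN p ≫ D''.hat.mulN p ≫ D''.hat.mulN p := by
          rw [h3'']; simp only [Category.assoc]
  -- (2) the same through `ξ = [p] ≫ φ♭`
  have hY : (c ≫ d' ≫ q₀) ≫ lamB₂ ≫ DualPair.dualIsogenyOver (c ≫ d' ≫ q₀) D'' DB₂ =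
      A''.mulN p ≫ (φ ≫ lamB₂ ≫ DualPair.dualIsogenyOver φ D'' DB₂) ≫ D''.hat.mulN p := by
    rw [DualPair.dualIsogenyOver_congr D'' DB₂ (h₁ := (inferInstance : IsMonHom (c ≫ d' ≫ q₀)))
        (h₂ := (inferInstance : IsMonHom (A''.mulN p ≫ φ))) hφ.symm,
      DualPair.dualIsogenyOver_comp (A''.mulN p) φ D'' D'' DB₂, D''.dualIsogenyOver_mulN hD'' p, ← hφ]
    simp only [Category.assoc]
  -- (3) cancel `[p]` on the left and on the right
  have hZ : A''.mulN p ≫ (φ ≫ lamB₂ ≫ DualPair.dualIsogenyOver φ D'' DB₂) ≫ D''.hat.mulN p =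
      A''.mulN p ≫ (pol''.lam ≫ D''.hat.mulN p) ≫ D''.hat.mulN p := by
    calc A''.mulN p ≫ (φ ≫ lamB₂ ≫ DualPair.dualIsogenyOver φ D'' DB₂) ≫ D''.hat.mulN p
        = (c ≫ d' ≫ q₀) ≫ lamB₂ ≫ DualPair.dualIsogenyOver (c ≫ d' ≫ q₀) D'' DB₂ := hY.symm
      _ = pol''.lam ≫ D''.hat.mulN p ≫ D''.hat.mulN p ≫ D''.hat.mulN p := hX
      _ = (A''.mulN p ≫ pol''.lam) ≫ D''.hat.mulN p ≫ D''.hat.mulN p := by rw [hlam'', Category.assoc]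
      _ = A''.mulN p ≫ (pol''.lam ≫ D''.hat.mulN p) ≫ D''.hat.mulN p := by simp only [Category.assoc]
  have hZ' : (φ ≫ lamB₂ ≫ DualPair.dualIsogenyOver φ D'' DB₂) ≫ D''.hat.mulN p = (pol''.lam ≫ D''.hat.mulN p) ≫ D''.hat.mulN p :=
    A''.cancel_left_of_flat_surjective (A''.mulN p) hZ
  exact A''.cancel_right_of_comp_eq_pow_id (D''.hat.mulN p) (𝟙 _) hp (by rw [Category.comp_id, mulN_def]) _ _ hZ'

/-- **(LVL) `φ♭(σ″ᵢ) = c₀(σᵗᵢ)`** for `N`-torsion families `σ″`, `σᵗ` and `p·m ≡ 1 (N)`: `φ♭(σ″) = φ♭((σ″^m)^p) = ξ(σ″)^m = (q₀ d′ q σ)^m = (q₀ σ)^{pm} =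
(c₀ σᵗ)^{pm} = c₀(σᵗ)`. [cite: MumfordFogartyKirwan1994, Ch. 7 §2 Definition 7.1 (p. 129)] [cite: Liu2021, Prop. D.8 (3) p. 135] -/
theorem map_flatLeg_level [IsMonHom c] [IsMonHom q₀] {p : ℕ} (d' : B.X ⟶ A.X) [IsMonHom d'] (hqd' : q ≫ d' = A.mulN p)
    (c₀ : At.X ⟶ B₂.X) [IsMonHom c₀]
    (φ : A''.X ⟶ B₂.X) [IsMonHom φ] (hφ : A''.mulN p ≫ φ = c ≫ d' ≫ q₀)
    {J : Type*} (σ : J → A.toAffine.toAbelianVariety.Points Ω) (σ'' : J → A''.toAffine.toAbelianVariety.Points Ω)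
    (σt : J → At.toAffine.toAbelianVariety.Points Ω)
    (h5 : ∀ i, (AlgPoints.map q (σ i) : B.toAffine.toAbelianVariety.Points Ω) = AlgPoints.map c (σ'' i))
    (h5₀ : ∀ i, (AlgPoints.map q₀ (σ i) : B₂.toAffine.toAbelianVariety.Points Ω) = AlgPoints.map c₀ (σt i))
    {N : ℕ} (hσ'' : ∀ i, σ'' i ^ N = 1) (hσt : ∀ i, σt i ^ N = 1) (m : ℕ) (hm : p * m ≡ 1 [MOD N]) (i : J) :
    (AlgPoints.map φ (σ'' i) : B₂.toAffine.toAbelianVariety.Points Ω) = AlgPoints.map c₀ (σt i) := by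
  haveI : IsCommMonObj A.X := A.isCommMonObj_of_isReduced_base
  haveI : IsCommMonObj A''.X := A''.isCommMonObj_of_isReduced_base
  haveI : IsMonHom (A.mulN p) := A.isMonHom_mulN p
  haveI : IsMonHom (A''.mulN p) := A''.isMonHom_mulN p
  have hm' : (p * m) % N = 1 % N := hm
  have hσ''i : σ'' i ^ (p * m) = σ'' i := by rw [pow_eq_pow_mod (p * m) (hσ'' i), hm', ← pow_eq_pow_mod 1 (hσ'' i), pow_one]
  have hσti : σt i ^ (p * m) = σt i := by rw [pow_eq_pow_mod (p * m) (hσt i), hm', ← pow_eq_pow_mod 1 (hσt i), pow_one]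
  have h5i := h5 i
  have h5₀i := h5₀ i
  rw [AlgPoints.map_apply, AlgPoints.map_apply] at h5i h5₀i ⊢
  -- the computation, on points read as morphisms `Spec Ω → A`, `A″`, `A_t` (`σ″ = (σ″^m)^p` and `[p] ≫ φ = ξ`)
  have key : ∀ (s : specOver Ω Ω ⟶ A.X) (s'' : specOver Ω Ω ⟶ A''.X) (st : specOver Ω Ω ⟶ At.X),
      s ≫ q = s'' ≫ c → s ≫ q₀ = st ≫ c₀ → s'' ^ (p * m) = s'' → st ^ (p * m) = st → s'' ≫ φ = st ≫ c₀ := by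
    intro s s'' st hs hs₀ hs'' hst
    have hpow : s'' = (s'' ^ m) ≫ A''.mulN p := by
      rw [mulN_def, MonObj.comp_pow, Category.comp_id, ← pow_mul, mul_comm]; exact hs''.symm
    calc s'' ≫ φ = (s'' ^ m) ≫ (A''.mulN p ≫ φ) := by rw [← Category.assoc, ← hpow]
      _ = (s'' ≫ c ≫ d' ≫ q₀) ^ m := by rw [hφ, MonObj.pow_comp]
      _ = ((s'' ≫ c) ≫ d' ≫ q₀) ^ m := by rw [← Category.assoc s'' c (d' ≫ q₀)]
      _ = ((s ≫ q) ≫ d' ≫ q₀) ^ m := by rw [← hs]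
      _ = (s ≫ (q ≫ d') ≫ q₀) ^ m := by simp only [Category.assoc]
      _ = ((s ≫ q₀) ^ p) ^ m := by rw [hqd', mulN_def, ← Category.assoc, MonObj.comp_pow, Category.comp_id, MonObj.pow_comp]
      _ = (st ≫ c₀) ^ (p * m) := by rw [hs₀, pow_mul]
      _ = st ≫ c₀ := by rw [← MonObj.pow_comp, hst]
  exact key (σ i) (σ'' i) (σt i) h5i h5₀i hσ''i hσti

/-! ## §4 The kernel of `φ♭` on `Ω`-points, block by block -/

/-- **(K2♭) + (V♭ ⇒)**: an `Ω`-point `P″` killed by `φ♭` is killed by `ι″(𝔭𝔭′)`, and `c P″ = q R` for some `R ∈ A[𝔭′]`: with `x^p = P″`, `R := d′(c x)` is killed by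
`q₀` (`q₀ R = ξ x = φ♭ P″ = 1`), hence `𝔭′`-torsion; `c P″ = (c x)^p = q R`; and for `β ∈ 𝔭′`, `c (ι″(β) P″) = b_β (q R) = q (ι(β) R) = 1` puts `ι″(β)P″` in
`Ker c ⊆ A″[𝔭]`. [cite: Liu2021, Prop. D.8 (2)(3) p. 135, pp. 136–138] [cite: MumfordAV1970, §7 Thm. 4 (p. 72)] -/
theorem flatLeg_kernel_torsion_and_image [IsAlgClosed Ω] [IsMonHom q] [IsMonHom c] {p : ℕ} (hp : p ≠ 0) (𝔭 𝔭' : Ideal O)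
    (d' : B.X ⟶ A.X) (hd'q : d' ≫ q = B.mulN p)
    (hck : ∀ P : specOver Ω Ω ⟶ A''.X, P ≫ c = 1 → ∀ a ∈ 𝔭, P ≫ act''.i a = 1)
    (hq₀k : ∀ P : specOver Ω Ω ⟶ A.X, P ≫ q₀ = 1 → ∀ a ∈ 𝔭', P ≫ act.i a = 1)
    (h4 : ∀ a : O, ∃ b : B.X ⟶ B.X, act.i a ≫ q = q ≫ b ∧ act''.i a ≫ c = c ≫ b)
    (φ : A''.X ⟶ B₂.X) (hφ : A''.mulN p ≫ φ = c ≫ d' ≫ q₀)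
    (P'' : specOver Ω Ω ⟶ A''.X) (hP : P'' ≫ φ = 1) :
    (∀ a ∈ 𝔭 * 𝔭', P'' ≫ act''.i a = 1) ∧
      ∃ R : specOver Ω Ω ⟶ A.X, (∀ a ∈ 𝔭', R ≫ act.i a = 1) ∧ P'' ≫ c = R ≫ q := by
  haveI := act.isMonHom
  haveI := act''.isMonHom
  haveI : IsCommMonObj A''.X := A''.isCommMonObj_of_isReduced_base
  haveI : IsCommMonObj B.X := B.isCommMonObj_of_isReduced_base
  haveI : IsMonHom (A''.mulN p) := A''.isMonHom_mulN p
  haveI : IsMonHom (B.mulN p) := B.isMonHom_mulN p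
  haveI : Surjective (A''.mulN p).left := A''.surjective_pow_id_left_of_ne_zero hp
  haveI : LocallyOfFiniteType A''.X.hom := (inferInstance : LocallyOfFiniteType A''.toAffine.toAbelianVariety.X.hom)
  -- a `p`-th root `x` of `P″`
  obtain ⟨x, hx⟩ := AlgPoints.map_surjective_of_surjective_of_isAlgClosed' (L := Ω) (A''.mulN p) P''
  rw [AlgPoints.map_apply] at hx
  have hxp : x ^ p = P'' := by rw [← hx, mulN_def, MonObj.comp_pow, Category.comp_id]
  -- `R := d′(c x)` is killed by `q₀`
  have ha' : (x ≫ c ≫ d') ≫ q₀ = 1 := by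
    have h : x ≫ (A''.mulN p ≫ φ) = 1 := by rw [← Category.assoc, hx, hP]
    rw [hφ] at h
    simpa only [Category.assoc] using h
  have ha'𝔭' : ∀ a ∈ 𝔭', (x ≫ c ≫ d') ≫ act.i a = 1 := hq₀k _ ha'
  -- `c P″ = q R`
  have hcP : P'' ≫ c = (x ≫ c ≫ d') ≫ q := by
    rw [← hxp, MonObj.pow_comp, Category.assoc, Category.assoc, hd'q, mulN_def, MonObj.comp_pow, Category.comp_id, MonObj.comp_pow]
  refine ⟨?_, x ≫ c ≫ d', ha'𝔭', hcP⟩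
  -- `ι″(β)P″ ∈ Ker c ⊆ A″[𝔭]` for `β ∈ 𝔭′`, so `ι″(𝔭′𝔭)` kills `P″`
  have hu : ∀ β ∈ 𝔭', ∀ α ∈ 𝔭, (P'' ≫ act''.i β) ≫ act''.i α = 1 := fun β hβ => by
    obtain ⟨b, hbq, hbc⟩ := h4 β
    refine hck _ ?_
    rw [Category.assoc, hbc, ← Category.assoc, hcP, Category.assoc, ← hbq, ← Category.assoc, ha'𝔭' β hβ, MonObj.one_comp]
  have h := forall_mem_mul_of_forall_forall act'' P'' hu
  rwa [mul_comm] at h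

/-- **(V♭ ⇐)**: `P″ ∈ A″[𝔭′]` with `c P″ = q R`, `R ∈ A[𝔭′]` ⟹ `φ♭ P″ = 1`.  With `x^p = P″`, `a := d′(c x)` has `ι(p) a = d′(c P″) = d′(q R) = ι(p) R` and, for `β′ ∈ 𝔭′`,
`ι(β′) a = d′ c (ι″(β′) x)` with `(ι″(β′)x)^p = ι″(β′)P″ = 1`, so `ι(𝔭′) ι(β′) a = 1` (§2); writing `β = β₂ + s·p` with `β₂ ∈ 𝔭′²` (`𝔭′ ⊆ 𝔭′² + (p)`) gives
`ι(β) a = ι(s)(ι(p) R) = ι(sp) R = 1`; so `a ∈ A[𝔭′] ⊆ Ker q₀` and `φ♭ P″ = q₀ a = 1`. [cite: Liu2021, Prop. D.8 (2)(3) p. 135, pp. 136–138] [cite: MumfordAV1970, §7 Thm. 4 (p. 72)] -/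
theorem map_flatLeg_eq_one_of_image [IsAlgClosed Ω] [IsMonHom c] {p : ℕ} (hp : p ≠ 0) (𝔭 𝔭' : Ideal O) (hp𝔭' : (p : O) ∈ 𝔭')
    (h𝔭'unr : 𝔭' ≤ 𝔭' ^ 2 ⊔ Ideal.span {(p : O)})
    (d' : B.X ⟶ A.X) [IsMonHom d'] (hqd' : q ≫ d' = A.mulN p) (hd'q : d' ≫ q = B.mulN p)
    (hK : ∀ P : specOver Ω Ω ⟶ A.X, P ≫ q = 1 → ∀ a ∈ 𝔭 * 𝔭', P ≫ act.i a = 1)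
    (hkc : ∀ P : specOver Ω Ω ⟶ A''.X, (∀ a ∈ 𝔭, P ≫ act''.i a = 1) → P ≫ c = 1)
    (hkq₀ : ∀ P : specOver Ω Ω ⟶ A.X, (∀ a ∈ 𝔭', P ≫ act.i a = 1) → P ≫ q₀ = 1)
    (hequiv : ∀ a : O, act''.i a ≫ c ≫ d' = c ≫ d' ≫ act.i a)
    (ε : O) (hε1 : ε - 1 ∈ 𝔭) (hε2 : ∀ α ∈ 𝔭, α * ε ∈ Ideal.span {(p : O)})
    (φ : A''.X ⟶ B₂.X) (hφ : A''.mulN p ≫ φ = c ≫ d' ≫ q₀)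
    (P'' : specOver Ω Ω ⟶ A''.X) (hP𝔭' : ∀ a ∈ 𝔭', P'' ≫ act''.i a = 1)
    (R : specOver Ω Ω ⟶ A.X) (hR : ∀ a ∈ 𝔭', R ≫ act.i a = 1) (hcq : P'' ≫ c = R ≫ q) :
    P'' ≫ φ = 1 := by
  haveI := act.isMonHom
  haveI := act''.isMonHom
  haveI : IsCommMonObj A.X := A.isCommMonObj_of_isReduced_base
  haveI : IsCommMonObj A''.X := A''.isCommMonObj_of_isReduced_base
  haveI : IsCommMonObj B.X := B.isCommMonObj_of_isReduced_base
  haveI : IsMonHom (A.mulN p) := A.isMonHom_mulN p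
  haveI : IsMonHom (A''.mulN p) := A''.isMonHom_mulN p
  haveI : IsMonHom (B.mulN p) := B.isMonHom_mulN p
  haveI : Surjective (A''.mulN p).left := A''.surjective_pow_id_left_of_ne_zero hp
  haveI : LocallyOfFiniteType A''.X.hom := (inferInstance : LocallyOfFiniteType A''.toAffine.toAbelianVariety.X.hom)
  obtain ⟨x, hx⟩ := AlgPoints.map_surjective_of_surjective_of_isAlgClosed' (L := Ω) (A''.mulN p) P''
  rw [AlgPoints.map_apply] at hx
  have hxp : x ^ p = P'' := by rw [← hx, mulN_def, MonObj.comp_pow, Category.comp_id]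
  -- `φ♭ P″ = q₀ a`
  have hφP : P'' ≫ φ = (x ≫ c ≫ d') ≫ q₀ := by
    rw [← hx, Category.assoc, hφ]; simp only [Category.assoc]
  rw [hφP]
  refine hkq₀ _ fun β hβ => ?_
  -- `ι(𝔭′) ι(β′) a = 1` for every `β′ ∈ 𝔭′` (§2 at the `p`-torsion point `ι″(β′) x`)
  have hu : ∀ β' ∈ 𝔭', ∀ b' ∈ 𝔭', ((x ≫ c ≫ d') ≫ act.i β') ≫ act.i b' = 1 := fun β' hβ' => by
    have hxβ : (x ≫ act''.i β') ^ p = 1 := by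
      rw [← MonObj.pow_comp, hxp]; exact hP𝔭' β' hβ'
    have h := cover_comp_returnHom_torsion_of_pow_eq_one act act'' q c 𝔭 𝔭' d' hd'q hK hkc hequiv ε hε1 hε2 (x ≫ act''.i β') hxβ
    have heq : (x ≫ act''.i β') ≫ c ≫ d' = (x ≫ c ≫ d') ≫ act.i β' := by
      rw [Category.assoc, hequiv β']; simp only [Category.assoc]
    rw [← heq]; exact h
  have h2 : ∀ b' ∈ 𝔭' * 𝔭', (x ≫ c ≫ d') ≫ act.i b' = 1 := forall_mem_mul_of_forall_forall act _ hu
  -- `ι(p) a = ι(p) R`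
  have hap : (x ≫ c ≫ d') ≫ act.i (p : O) = R ≫ act.i (p : O) := by
    rw [comp_i_natCast, comp_i_natCast, ← MonObj.pow_comp, hxp, ← Category.assoc, hcq, Category.assoc, hqd', mulN_def, MonObj.comp_pow,
      Category.comp_id]
  -- `β = β₂ + s·p`, `β₂ ∈ 𝔭′²`
  obtain ⟨β₂, hβ₂, t, ht, hβt⟩ := Submodule.mem_sup.mp (h𝔭'unr hβ)
  obtain ⟨s, rfl⟩ := Ideal.mem_span_singleton'.mp ht
  rw [← hβt, act.comp_i_add, h2 β₂ (by rw [← pow_two]; exact hβ₂), one_mul, act.comp_i_mul, hap, ← act.comp_i_mul]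
  exact hR _ (𝔭'.mul_mem_left s hp𝔭')

/-- **(W♭ ⇐)**: `R ∈ A[𝔭]`, `c x = q R` ⟹ `φ♭(x^p) = 1` and `x^p ∈ A″[𝔭]`: `φ♭(x^p) = ξ x = q₀ d′ (q R) = q₀ (ι(p) R) = 1` (`p ∈ 𝔭`); and `ι″(α) x ∈ Ker c ⊆ A″[𝔭]`
for `α ∈ 𝔭` (`c ι″(α) x = b_α q R = q ι(α) R = 1`), so `ι″(α)(x^p) = ι″(p)(ι″(α)x) = 1`. [cite: Liu2021, Prop. D.8 (2)(3) p. 135, pp. 136–138]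
[cite: MumfordAV1970, §7 Thm. 4 (p. 72)] -/
theorem map_flatLeg_pow_eq_one [IsMonHom q] [IsMonHom q₀] {p : ℕ} (𝔭 : Ideal O) (hp𝔭 : (p : O) ∈ 𝔭)
    (d' : B.X ⟶ A.X) (hqd' : q ≫ d' = A.mulN p)
    (hck : ∀ P : specOver Ω Ω ⟶ A''.X, P ≫ c = 1 → ∀ a ∈ 𝔭, P ≫ act''.i a = 1)
    (h4 : ∀ a : O, ∃ b : B.X ⟶ B.X, act.i a ≫ q = q ≫ b ∧ act''.i a ≫ c = c ≫ b)
    (φ : A''.X ⟶ B₂.X) (hφ : A''.mulN p ≫ φ = c ≫ d' ≫ q₀)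
    (R : specOver Ω Ω ⟶ A.X) (hR : ∀ a ∈ 𝔭, R ≫ act.i a = 1) (x : specOver Ω Ω ⟶ A''.X) (hcq : x ≫ c = R ≫ q) :
    (x ^ p) ≫ φ = 1 ∧ ∀ a ∈ 𝔭, (x ^ p) ≫ act''.i a = 1 := by
  haveI := act.isMonHom
  haveI := act''.isMonHom
  haveI : IsCommMonObj A.X := A.isCommMonObj_of_isReduced_base
  haveI : IsCommMonObj A''.X := A''.isCommMonObj_of_isReduced_base
  haveI : IsMonHom (A.mulN p) := A.isMonHom_mulN p
  haveI : IsMonHom (A''.mulN p) := A''.isMonHom_mulN p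
  have hxp : x ^ p = x ≫ A''.mulN p := by rw [mulN_def, MonObj.comp_pow, Category.comp_id]
  have hRp : R ≫ A.mulN p = 1 := by
    rw [mulN_def, MonObj.comp_pow, Category.comp_id, ← comp_i_natCast act R p]; exact hR _ hp𝔭
  constructor
  · rw [hxp, Category.assoc, hφ, ← Category.assoc, hcq, Category.assoc, ← Category.assoc q d' q₀, hqd', ← Category.assoc, hRp, MonObj.one_comp]
  · intro α hα
    obtain ⟨b, hbq, hbc⟩ := h4 α
    have hxα : (x ≫ act''.i α) ≫ c = 1 := by
      rw [Category.assoc, hbc, ← Category.assoc, hcq, Category.assoc, ← hbq, ← Category.assoc, hR α hα, MonObj.one_comp]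
    have h := hck _ hxα (p : O) hp𝔭
    rw [← comp_i_natCast act'' x p, ← act''.comp_i_mul, mul_comm, act''.comp_i_mul]
    exact h

/-- **(W♭ ⇒)**: `φ♭ P″ = 1`, `P″ ∈ A″[𝔭]` ⟹ `P″ = x^p` with `c x = q R`, `R ∈ A[𝔭]` (the `d`-free reading of «`P″ ∈ (q ≫ d)(A[𝔭])`» for the cover's return hom `d`).  Take
`x₀^p = P″`, `a := d′(c x₀) ∈ A[𝔭′]` and `x := ι″(ε) x₀` for the CRT element `ε ≡ 1 (𝔭)`, `ε𝔭 ⊆ (p)`, `ε ∈ 𝔭′`: then `x^p = ι″(ε)P″ = P″`; `d′(c x) = ι(ε) a = 1`, so `c x = q z`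
(`q` onto on points) with `z^p = d′(q z) = 1`; and `R := ι(ε) z ∈ A[𝔭]` has `q R = b_ε(c x) = c(ι″(ε²) x₀) = c x`, because `ε² − ε ∈ (p)` and `c` kills `ι″(r)P″ ∈ A″[𝔭]`.
[cite: Liu2021, Prop. D.8 (2)(3) p. 135, pp. 136–138] [cite: MumfordAV1970, §7 Thm. 4 (p. 72)] -/
theorem exists_pow_eq_of_map_flatLeg_eq_one [IsAlgClosed Ω] [IsMonHom c] [Surjective q.left] {p : ℕ} (hp : p ≠ 0) (𝔭 𝔭' : Ideal O)
    (d' : B.X ⟶ A.X) (hqd' : q ≫ d' = A.mulN p)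
    (hkc : ∀ P : specOver Ω Ω ⟶ A''.X, (∀ a ∈ 𝔭, P ≫ act''.i a = 1) → P ≫ c = 1)
    (hq₀k : ∀ P : specOver Ω Ω ⟶ A.X, P ≫ q₀ = 1 → ∀ a ∈ 𝔭', P ≫ act.i a = 1)
    (h4 : ∀ a : O, ∃ b : B.X ⟶ B.X, act.i a ≫ q = q ≫ b ∧ act''.i a ≫ c = c ≫ b)
    (hequiv : ∀ a : O, act''.i a ≫ c ≫ d' = c ≫ d' ≫ act.i a)
    (ε : O) (hε1 : ε - 1 ∈ 𝔭) (hε2 : ∀ α ∈ 𝔭, α * ε ∈ Ideal.span {(p : O)}) (hε3 : ε ∈ 𝔭')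
    (φ : A''.X ⟶ B₂.X) (hφ : A''.mulN p ≫ φ = c ≫ d' ≫ q₀)
    (P'' : specOver Ω Ω ⟶ A''.X) (hP : P'' ≫ φ = 1) (hP𝔭 : ∀ a ∈ 𝔭, P'' ≫ act''.i a = 1) :
    ∃ R : specOver Ω Ω ⟶ A.X, (∀ a ∈ 𝔭, R ≫ act.i a = 1) ∧ ∃ x : specOver Ω Ω ⟶ A''.X, x ≫ c = R ≫ q ∧ P'' = x ^ p := by
  haveI := act.isMonHom
  haveI := act''.isMonHom
  haveI : IsCommMonObj A.X := A.isCommMonObj_of_isReduced_base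
  haveI : IsCommMonObj A''.X := A''.isCommMonObj_of_isReduced_base
  haveI : IsCommMonObj B.X := B.isCommMonObj_of_isReduced_base
  haveI : IsMonHom (A.mulN p) := A.isMonHom_mulN p
  haveI : IsMonHom (A''.mulN p) := A''.isMonHom_mulN p
  haveI : Surjective (A''.mulN p).left := A''.surjective_pow_id_left_of_ne_zero hp
  haveI : LocallyOfFiniteType A''.X.hom := (inferInstance : LocallyOfFiniteType A''.toAffine.toAbelianVariety.X.hom)
  haveI : LocallyOfFiniteType A.X.hom := (inferInstance : LocallyOfFiniteType A.toAffine.toAbelianVariety.X.hom)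
  -- `x₀` with `x₀^p = P″`
  obtain ⟨x₀, hx₀⟩ := AlgPoints.map_surjective_of_surjective_of_isAlgClosed' (L := Ω) (A''.mulN p) P''
  rw [AlgPoints.map_apply] at hx₀
  have hx₀p : x₀ ^ p = P'' := by rw [← hx₀, mulN_def, MonObj.comp_pow, Category.comp_id]
  -- `a := d′(c x₀) ∈ A[𝔭′]`
  have ha' : (x₀ ≫ c ≫ d') ≫ q₀ = 1 := by
    have h : x₀ ≫ (A''.mulN p ≫ φ) = 1 := by rw [← Category.assoc, hx₀, hP]
    rw [hφ] at h
    simpa only [Category.assoc] using h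
  have ha'𝔭' : ∀ a ∈ 𝔭', (x₀ ≫ c ≫ d') ≫ act.i a = 1 := hq₀k _ ha'
  -- `x := ι″(ε) x₀`: `x^p = P″` and `d′(c x) = ι(ε) a = 1`
  have hxp : (x₀ ≫ act''.i ε) ^ p = P'' := by
    rw [← MonObj.pow_comp, hx₀p]; exact comp_i_eq_self_of_sub_one_mem act'' P'' hP𝔭 hε1
  have hxcd : (x₀ ≫ act''.i ε) ≫ c ≫ d' = 1 := by
    rw [Category.assoc, hequiv ε, ← Category.assoc c d' (act.i ε), ← Category.assoc]
    exact ha'𝔭' ε hε3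
  -- `z` with `q z = c x` (`q` is onto on `Ω`-points); `z^p = d′(c x) = 1`
  obtain ⟨z, hz⟩ := AlgPoints.map_surjective_of_surjective_of_isAlgClosed' (L := Ω) q ((x₀ ≫ act''.i ε) ≫ c)
  rw [AlgPoints.map_apply] at hz
  have hzp : z ^ p = 1 := by
    calc z ^ p = z ≫ A.mulN p := by rw [mulN_def, MonObj.comp_pow, Category.comp_id]
      _ = (z ≫ q) ≫ d' := by rw [Category.assoc, hqd']
      _ = 1 := by rw [hz, Category.assoc, hxcd]
  -- `c(ι″(ε²) x₀) = c(ι″(ε) x₀)`: `ε² − ε = (ε − 1)ε ∈ (p)` and `c` kills `ι″(r) P″ ∈ A″[𝔭]`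
  have hεεc : (x₀ ≫ act''.i (ε * ε)) ≫ c = (x₀ ≫ act''.i ε) ≫ c := by
    obtain ⟨r, hr⟩ := Ideal.mem_span_singleton'.mp (hε2 (ε - 1) hε1)
    have e : ε * ε = ε + (ε - 1) * ε := by ring
    have hkill : (x₀ ≫ act''.i ((ε - 1) * ε)) ≫ c = 1 := by
      rw [← hr, act''.comp_i_mul, comp_i_natCast act'' x₀ p, hx₀p]
      refine hkc _ fun a ha => ?_
      rw [← act''.comp_i_mul, mul_comm, act''.comp_i_mul, hP𝔭 a ha, MonObj.one_comp]
    rw [e, act''.comp_i_add, MonObj.mul_comp, hkill, mul_one]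
  -- `R := ι(ε) z`
  obtain ⟨b, hbq, hbc⟩ := h4 ε
  refine ⟨z ≫ act.i ε, fun α hα => ?_, x₀ ≫ act''.i ε, ?_, hxp.symm⟩
  · obtain ⟨r, hr⟩ := Ideal.mem_span_singleton'.mp (hε2 α hα)
    rw [← act.comp_i_mul, ← hr, act.comp_i_mul, comp_i_natCast act z p, hzp, MonObj.one_comp]
  · have key : (z ≫ act.i ε) ≫ q = (x₀ ≫ act''.i ε) ≫ c := by
      calc (z ≫ act.i ε) ≫ q = (z ≫ q) ≫ b := by rw [Category.assoc, hbq, Category.assoc]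
        _ = ((x₀ ≫ act''.i ε) ≫ act''.i ε) ≫ c := by
            rw [hz, Category.assoc (x₀ ≫ act''.i ε) c b, ← hbc, ← Category.assoc (x₀ ≫ act''.i ε) (act''.i ε) c]
        _ = (x₀ ≫ act''.i (ε * ε)) ≫ c := by rw [← act''.comp_i_mul]
        _ = (x₀ ≫ act''.i ε) ≫ c := hεεc
    exact key.symm

end FlatLeg

end AbelianSchemeOver

end Literature.AlgebraicGeometry.AbelianSchemes

end
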